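import Literature.MathematicalPhysics.KineticTheory.LangevinChainNESSProofs
import Mathlib.Analysis.Calculus.FDeriv.Symmetric
import HarnessLib

/-!
# The canonical Poisson bracket on the phase space `ℝ^N × ℝ^N`

`Literature/MathematicalPhysics/KineticTheory/` — calculus of the canonical Poisson bracket
`{f, g} = ∑_x (∂_{p_x} f ∂_{q_x} g - ∂_{q_x} f ∂_{p_x} g)` of functions on the tree's phase space
`PhaseSpace N = (Fin N → ℝ) × (Fin N → ℝ)` (coordinate derivatives `partialQ`, `partialP` of
`FouriersLaw.lean`). This is the bracket `L_f g = {f, g}` of De Roeck–Huveneers 2015 (§2.2 eq. (2.4):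
"`L_f g = {f, g} = ∇_ω f · ∇_q g - ∇_q f · ∇_ω g`"), whose iterates `L_U^k` build the formal
canonical transformations of their §3; the Liouville operator of the rotor chain
(`RotorChain.liouville` of `AnticontinuumLocalization.lean`) is `{H, ·}` definitionally.

## Contents (all proved)

* `poisson f g` (the bracket), `poisson_eq_fderiv` (coordinate-free form for differentiable
  functions), antisymmetry `poisson_antisymm`, `poisson_self`, bilinearity (`poisson_add_left`, …,
  for differentiable arguments), constants `poisson_const_left/right`, the Leibniz rule
  `poisson_mul_right` (`{f, gh} = g{f, h} + h{f, g}`), locality `poisson_eq_zero_of_fderiv_eq_zero`;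
* smoothness: `contDiff_partialQ`, `contDiff_poisson` (`f, g ∈ C^{n+1} ⇒ {f, g} ∈ C^n`),
  `contDiff_top_poisson` (`C^∞` is closed under the bracket);
* the derivative of a bracket `fderiv_poisson_apply` and the **Jacobi identity** `poisson_jacobi`
  (`{f,{g,h}} + {g,{h,f}} + {h,{f,g}} = 0` for `f, g, h ∈ C²`), proved by splitting `{f,{g,h}}`
  into the part `B(f,g,h)` where the second derivative falls on `g` and `-B(f,h,g)`, and the
  symmetry `B(h,g,f) = B(f,g,h)` (Schwarz: `IsSymmSndFDerivAt`, and exchanging the two sums).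

## References

* V. I. Arnold, *Mathematical Methods of Classical Mechanics*, GTM 60, 2nd ed. (1989), §40
  (Poisson bracket: bilinearity, Leibniz rule, Jacobi identity (C)). [Arnold1989]
* W. De Roeck, F. Huveneers, CPAM 68 (2015), arXiv:1305.5127, §2.2 eq. (2.4). [DeRoeckHuveneers2015]
-/

noncomputable section

open Function Set Filter
open scoped ContDiff Topology BigOperators

namespace Literature.MathematicalPhysics.KineticTheory.HeatConduction

variable {N : ℕ}

/-! ### The bracket -/

/-- The canonical Poisson bracket `{f, g} = ∑_x (∂_{p_x} f ∂_{q_x} g - ∂_{q_x} f ∂_{p_x} g)` on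
`PhaseSpace N` (coordinate derivatives; junk value where the slices are not differentiable).
[cite: DeRoeckHuveneers2015, §2.2 eq. (2.4)] -/
def poisson (f g : PhaseSpace N → ℝ) (z : PhaseSpace N) : ℝ :=
  ∑ x : Fin N, (partialP x f z * partialQ x g z - partialQ x f z * partialP x g z)

/-- Antisymmetry `{f, g} = -{g, f}` (unconditionally). [cite: Arnold1989, §40 (C)] -/
theorem poisson_antisymm (f g : PhaseSpace N → ℝ) (z : PhaseSpace N) : poisson f g z = -poisson g f z := by
  unfold poisson
  rw [← Finset.sum_neg_distrib]
  exact Finset.sum_congr rfl fun x _ => by ring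

/-- `{f, f} = 0`. [folklore] -/
theorem poisson_self (f : PhaseSpace N → ℝ) (z : PhaseSpace N) : poisson f f z = 0 := by
  unfold poisson
  exact Finset.sum_eq_zero fun x _ => by ring

/-- Coordinate-free form: for differentiable `f, g`,
`{f, g}(z) = ∑_x (Df(z)(0,e_x) Dg(z)(e_x,0) - Df(z)(e_x,0) Dg(z)(0,e_x))`. [folklore] -/
theorem poisson_eq_fderiv {f g : PhaseSpace N → ℝ} (hf : Differentiable ℝ f) (hg : Differentiable ℝ g)
    (z : PhaseSpace N) :
    poisson f g z = ∑ x : Fin N,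
      (fderiv ℝ f z ((0, Pi.single x 1) : PhaseSpace N) * fderiv ℝ g z ((Pi.single x 1, 0) : PhaseSpace N) -
        fderiv ℝ f z ((Pi.single x 1, 0) : PhaseSpace N) * fderiv ℝ g z ((0, Pi.single x 1) : PhaseSpace N)) := by
  unfold poisson
  simp only [partialQ_eq_fderiv hf, partialQ_eq_fderiv hg, partialP_eq_fderiv hf, partialP_eq_fderiv hg]

/-- Locality: if `Dg(z) = 0` then `{f, g}(z) = 0` (for differentiable `f, g`). [folklore] -/
theorem poisson_eq_zero_of_fderiv_eq_zero {f g : PhaseSpace N → ℝ} (hf : Differentiable ℝ f)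
    (hg : Differentiable ℝ g) {z : PhaseSpace N} (hz : fderiv ℝ g z = 0) : poisson f g z = 0 := by
  rw [poisson_eq_fderiv hf hg, hz]
  simp

/-- Locality on the left: if `Df(z) = 0` then `{f, g}(z) = 0`. [folklore] -/
theorem poisson_eq_zero_of_fderiv_eq_zero_left {f g : PhaseSpace N → ℝ} (hf : Differentiable ℝ f)
    (hg : Differentiable ℝ g) {z : PhaseSpace N} (hz : fderiv ℝ f z = 0) : poisson f g z = 0 := by
  rw [poisson_antisymm, poisson_eq_zero_of_fderiv_eq_zero hg hf hz, neg_zero]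

/-! ### Algebra of the coordinate derivatives -/

/-- `∂_{q_i} (f + g) = ∂_{q_i} f + ∂_{q_i} g` for differentiable `f, g`. [folklore] -/
theorem partialQ_add {f g : PhaseSpace N → ℝ} (hf : Differentiable ℝ f) (hg : Differentiable ℝ g)
    (i : Fin N) (z : PhaseSpace N) : partialQ i (f + g) z = partialQ i f z + partialQ i g z := by
  simp only [partialQ_eq_fderiv hf, partialQ_eq_fderiv hg, partialQ_eq_fderiv (hf.add hg),
    fderiv_add (hf z) (hg z), add_apply]

/-- `∂_{p_i} (f + g) = ∂_{p_i} f + ∂_{p_i} g` for differentiable `f, g`. [folklore] -/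
theorem partialP_add {f g : PhaseSpace N → ℝ} (hf : Differentiable ℝ f) (hg : Differentiable ℝ g)
    (i : Fin N) (z : PhaseSpace N) : partialP i (f + g) z = partialP i f z + partialP i g z := by
  simp only [partialP_eq_fderiv hf, partialP_eq_fderiv hg, partialP_eq_fderiv (hf.add hg),
    fderiv_add (hf z) (hg z), add_apply]

/-- `∂_{q_i} (c f) = c ∂_{q_i} f` (unconditionally). [folklore] -/
theorem partialQ_const_mul (c : ℝ) (f : PhaseSpace N → ℝ) (i : Fin N) (z : PhaseSpace N) :
    partialQ i (fun w => c * f w) z = c * partialQ i f z := by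
  unfold partialQ
  exact deriv_const_mul_field c

/-- `∂_{p_i} (c f) = c ∂_{p_i} f` (unconditionally). [folklore] -/
theorem partialP_const_mul (c : ℝ) (f : PhaseSpace N → ℝ) (i : Fin N) (z : PhaseSpace N) :
    partialP i (fun w => c * f w) z = c * partialP i f z := by
  unfold partialP
  exact deriv_const_mul_field c

/-- `∂_{q_i} c = 0`. [folklore] -/
theorem partialQ_const (c : ℝ) (i : Fin N) (z : PhaseSpace N) : partialQ i (fun _ : PhaseSpace N => c) z = 0 := by
  simp [partialQ]

/-- `∂_{p_i} c = 0`. [folklore] -/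
theorem partialP_const (c : ℝ) (i : Fin N) (z : PhaseSpace N) : partialP i (fun _ : PhaseSpace N => c) z = 0 := by
  simp [partialP]

/-- Leibniz: `∂_{q_i} (f g) = f ∂_{q_i} g + g ∂_{q_i} f` for differentiable `f, g`. [folklore] -/
theorem partialQ_mul {f g : PhaseSpace N → ℝ} (hf : Differentiable ℝ f) (hg : Differentiable ℝ g)
    (i : Fin N) (z : PhaseSpace N) : partialQ i (f * g) z = f z * partialQ i g z + g z * partialQ i f z := by
  simp only [partialQ_eq_fderiv hf, partialQ_eq_fderiv hg, partialQ_eq_fderiv (hf.mul hg),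
    fderiv_mul (hf z) (hg z), add_apply, smul_apply, smul_eq_mul]

/-- Leibniz: `∂_{p_i} (f g) = f ∂_{p_i} g + g ∂_{p_i} f` for differentiable `f, g`. [folklore] -/
theorem partialP_mul {f g : PhaseSpace N → ℝ} (hf : Differentiable ℝ f) (hg : Differentiable ℝ g)
    (i : Fin N) (z : PhaseSpace N) : partialP i (f * g) z = f z * partialP i g z + g z * partialP i f z := by
  simp only [partialP_eq_fderiv hf, partialP_eq_fderiv hg, partialP_eq_fderiv (hf.mul hg),
    fderiv_mul (hf z) (hg z), add_apply, smul_apply, smul_eq_mul]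

/-! ### Bilinearity, constants, Leibniz rule for the bracket -/

/-- `{f₁ + f₂, g} = {f₁, g} + {f₂, g}` (differentiable arguments). [cite: Arnold1989, §40 (C)] -/
theorem poisson_add_left {f₁ f₂ g : PhaseSpace N → ℝ} (h₁ : Differentiable ℝ f₁) (h₂ : Differentiable ℝ f₂)
    (z : PhaseSpace N) : poisson (f₁ + f₂) g z = poisson f₁ g z + poisson f₂ g z := by
  unfold poisson
  rw [← Finset.sum_add_distrib]
  refine Finset.sum_congr rfl fun x _ => ?_
  rw [partialQ_add h₁ h₂, partialP_add h₁ h₂]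
  ring

/-- `{f, g₁ + g₂} = {f, g₁} + {f, g₂}` (differentiable arguments). [cite: Arnold1989, §40 (C)] -/
theorem poisson_add_right (f : PhaseSpace N → ℝ) {g₁ g₂ : PhaseSpace N → ℝ} (h₁ : Differentiable ℝ g₁)
    (h₂ : Differentiable ℝ g₂) (z : PhaseSpace N) :
    poisson f (g₁ + g₂) z = poisson f g₁ z + poisson f g₂ z := by
  rw [poisson_antisymm, poisson_add_left h₁ h₂, poisson_antisymm g₁ f, poisson_antisymm g₂ f]
  ring

/-- `{c f, g} = c {f, g}`. [cite: Arnold1989, §40 (C)] -/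
theorem poisson_const_mul_left (c : ℝ) (f g : PhaseSpace N → ℝ) (z : PhaseSpace N) :
    poisson (fun w => c * f w) g z = c * poisson f g z := by
  unfold poisson
  rw [Finset.mul_sum]
  refine Finset.sum_congr rfl fun x _ => ?_
  rw [partialQ_const_mul, partialP_const_mul]
  ring

/-- `{f, c g} = c {f, g}`. [cite: Arnold1989, §40 (C)] -/
theorem poisson_const_mul_right (c : ℝ) (f g : PhaseSpace N → ℝ) (z : PhaseSpace N) :
    poisson f (fun w => c * g w) z = c * poisson f g z := by
  rw [poisson_antisymm, poisson_const_mul_left, poisson_antisymm g f]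
  ring

/-- `{f, -g} = -{f, g}`. [folklore] -/
theorem poisson_neg_right (f g : PhaseSpace N → ℝ) (z : PhaseSpace N) :
    poisson f (fun w => -g w) z = -poisson f g z := by
  have := poisson_const_mul_right (-1) f g z
  simp only [neg_mul, one_mul] at this
  exact this

/-- `{-f, g} = -{f, g}`. [folklore] -/
theorem poisson_neg_left (f g : PhaseSpace N → ℝ) (z : PhaseSpace N) :
    poisson (fun w => -f w) g z = -poisson f g z := by
  rw [poisson_antisymm, poisson_neg_right, poisson_antisymm g f, neg_neg]

/-- `{f, g₁ - g₂} = {f, g₁} - {f, g₂}` (differentiable arguments). [folklore] -/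
theorem poisson_sub_right (f : PhaseSpace N → ℝ) {g₁ g₂ : PhaseSpace N → ℝ} (h₁ : Differentiable ℝ g₁)
    (h₂ : Differentiable ℝ g₂) (z : PhaseSpace N) :
    poisson f (g₁ - g₂) z = poisson f g₁ z - poisson f g₂ z := by
  rw [sub_eq_add_neg, poisson_add_right f h₁ h₂.neg, show (-g₂) = fun w => -g₂ w from rfl,
    poisson_neg_right]
  ring

/-- `{c, g} = 0` for a constant `c`. [cite: Arnold1989, §40] -/
theorem poisson_const_left (c : ℝ) (g : PhaseSpace N → ℝ) (z : PhaseSpace N) :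
    poisson (fun _ => c) g z = 0 := by
  unfold poisson
  exact Finset.sum_eq_zero fun x _ => by rw [partialQ_const, partialP_const]; ring

/-- `{f, c} = 0` for a constant `c`. [cite: Arnold1989, §40] -/
theorem poisson_const_right (f : PhaseSpace N → ℝ) (c : ℝ) (z : PhaseSpace N) :
    poisson f (fun _ => c) z = 0 := by
  rw [poisson_antisymm, poisson_const_left, neg_zero]

/-- A finite sum of differentiable functions, bracketed on the right. [folklore] -/
theorem poisson_sum_right {ι : Type*} (s : Finset ι) (f : PhaseSpace N → ℝ) {g : ι → PhaseSpace N → ℝ}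
    (hg : ∀ i ∈ s, Differentiable ℝ (g i)) (z : PhaseSpace N) :
    poisson f (fun w => ∑ i ∈ s, g i w) z = ∑ i ∈ s, poisson f (g i) z := by
  classical
  induction s using Finset.induction_on with
  | empty => simp [poisson_const_right]
  | @insert a s ha ih =>
    have hga : Differentiable ℝ (g a) := hg a (Finset.mem_insert_self a s)
    have hgs : ∀ i ∈ s, Differentiable ℝ (g i) := fun i hi => hg i (Finset.mem_insert_of_mem hi)
    have hsum : Differentiable ℝ (fun w => ∑ i ∈ s, g i w) := Differentiable.fun_sum fun i hi => hgs i hi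
    simp only [Finset.sum_insert ha]
    rw [show (fun w => g a w + ∑ i ∈ s, g i w) = g a + fun w => ∑ i ∈ s, g i w from rfl,
      poisson_add_right f hga hsum, ih hgs]

/-- A finite sum of differentiable functions, bracketed on the left. [folklore] -/
theorem poisson_sum_left {ι : Type*} (s : Finset ι) {f : ι → PhaseSpace N → ℝ}
    (hf : ∀ i ∈ s, Differentiable ℝ (f i)) (g : PhaseSpace N → ℝ) (z : PhaseSpace N) :
    poisson (fun w => ∑ i ∈ s, f i w) g z = ∑ i ∈ s, poisson (f i) g z := by
  rw [poisson_antisymm, poisson_sum_right s g hf, ← Finset.sum_neg_distrib]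
  exact Finset.sum_congr rfl fun i _ => (poisson_antisymm (f i) g z).symm

/-- **Leibniz rule** `{f, g h} = g {f, h} + h {f, g}` (differentiable arguments): `{f, ·}` is a
derivation of the pointwise product. [cite: Arnold1989, §40 (C)] -/
theorem poisson_mul_right (f : PhaseSpace N → ℝ) {g h : PhaseSpace N → ℝ} (hg : Differentiable ℝ g)
    (hh : Differentiable ℝ h) (z : PhaseSpace N) :
    poisson f (g * h) z = g z * poisson f h z + h z * poisson f g z := by
  unfold poisson
  rw [Finset.mul_sum, Finset.mul_sum, ← Finset.sum_add_distrib]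
  refine Finset.sum_congr rfl fun x _ => ?_
  rw [partialQ_mul hg hh, partialP_mul hg hh]
  ring

/-! ### Smoothness -/

/-- For `f ∈ C^{m+1}`, `∂_{q_i} f ∈ C^m`. [folklore] -/
theorem contDiff_partialQ {f : PhaseSpace N → ℝ} {m n : WithTop ℕ∞} (hf : ContDiff ℝ n f)
    (hmn : m + 1 ≤ n) (i : Fin N) : ContDiff ℝ m (partialQ i f) := by
  have hn : n ≠ 0 := by
    rintro rfl
    exact absurd hmn (by simp)
  rw [partialQ_eq_fderiv (hf.differentiable hn)]
  exact (hf.fderiv_right hmn).clm_apply contDiff_const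

/-- `f, g ∈ C^{m+1} ⇒ {f, g} ∈ C^m`. [folklore] -/
theorem contDiff_poisson {f g : PhaseSpace N → ℝ} {m n : WithTop ℕ∞} (hf : ContDiff ℝ n f)
    (hg : ContDiff ℝ n g) (hmn : m + 1 ≤ n) : ContDiff ℝ m (poisson f g) := by
  unfold poisson
  refine ContDiff.sum fun x _ => ?_
  exact ((contDiff_partialP hf hmn x).mul (contDiff_partialQ hg hmn x)).sub
    ((contDiff_partialQ hf hmn x).mul (contDiff_partialP hg hmn x))

/-- `C^∞` is closed under the bracket. [folklore] -/
theorem contDiff_top_poisson {f g : PhaseSpace N → ℝ} (hf : ContDiff ℝ ∞ f) (hg : ContDiff ℝ ∞ g) :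
    ContDiff ℝ ∞ (poisson f g) :=
  contDiff_poisson (m := ∞) (n := ∞) hf hg (by simp)

/-- `{f, g}` is differentiable for `f, g ∈ C²`. [folklore] -/
theorem differentiable_poisson {f g : PhaseSpace N → ℝ} (hf : ContDiff ℝ 2 f) (hg : ContDiff ℝ 2 g) :
    Differentiable ℝ (poisson f g) :=
  (contDiff_poisson (m := 1) hf hg (by norm_num)).differentiable one_ne_zero

/-! ### The derivative of a bracket; the Jacobi identity -/

/-- The derivative of `z ↦ Df(z)·w` is `v ↦ D²f(z)(v, w)`. [folklore] -/
theorem hasFDerivAt_fderiv_apply {f : PhaseSpace N → ℝ} (hf : ContDiff ℝ 2 f) (z w : PhaseSpace N) :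
    HasFDerivAt (fun y => fderiv ℝ f y w) ((fderiv ℝ (fderiv ℝ f) z).flip w) z := by
  have hd : DifferentiableAt ℝ (fderiv ℝ f) z :=
    ((hf.fderiv_right (m := 1) (by norm_num)).differentiable one_ne_zero) z
  have := hd.hasFDerivAt.clm_apply (hasFDerivAt_const w z)
  simpa using this

/-- **Derivative of a bracket** (`f, g ∈ C²`):
`D{f,g}(z)·v = ∑_x (D²f(v,P_x) Dg(Q_x) + Df(P_x) D²g(v,Q_x) - D²f(v,Q_x) Dg(P_x) - Df(Q_x) D²g(v,P_x))`
with `Q_x = (e_x, 0)`, `P_x = (0, e_x)`. [folklore] -/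
theorem fderiv_poisson_apply {f g : PhaseSpace N → ℝ} (hf : ContDiff ℝ 2 f) (hg : ContDiff ℝ 2 g)
    (z v : PhaseSpace N) :
    fderiv ℝ (poisson f g) z v = ∑ x : Fin N,
      (fderiv ℝ (fderiv ℝ f) z v ((0, Pi.single x 1) : PhaseSpace N) *
          fderiv ℝ g z ((Pi.single x 1, 0) : PhaseSpace N) +
        fderiv ℝ f z ((0, Pi.single x 1) : PhaseSpace N) *
          fderiv ℝ (fderiv ℝ g) z v ((Pi.single x 1, 0) : PhaseSpace N) -
        fderiv ℝ (fderiv ℝ f) z v ((Pi.single x 1, 0) : PhaseSpace N) *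
          fderiv ℝ g z ((0, Pi.single x 1) : PhaseSpace N) -
        fderiv ℝ f z ((Pi.single x 1, 0) : PhaseSpace N) *
          fderiv ℝ (fderiv ℝ g) z v ((0, Pi.single x 1) : PhaseSpace N)) := by
  have hfd : Differentiable ℝ f := hf.differentiable (by norm_num)
  have hgd : Differentiable ℝ g := hg.differentiable (by norm_num)
  have heq : poisson f g = fun z => ∑ x : Fin N,
      (fderiv ℝ f z ((0, Pi.single x 1) : PhaseSpace N) * fderiv ℝ g z ((Pi.single x 1, 0) : PhaseSpace N) -
        fderiv ℝ f z ((Pi.single x 1, 0) : PhaseSpace N) * fderiv ℝ g z ((0, Pi.single x 1) : PhaseSpace N)) :=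
    funext fun z => poisson_eq_fderiv hfd hgd z
  have key : HasFDerivAt (poisson f g) (∑ x : Fin N,
      ((fderiv ℝ f z ((0, Pi.single x 1) : PhaseSpace N) •
            (fderiv ℝ (fderiv ℝ g) z).flip ((Pi.single x 1, 0) : PhaseSpace N) +
          fderiv ℝ g z ((Pi.single x 1, 0) : PhaseSpace N) •
            (fderiv ℝ (fderiv ℝ f) z).flip ((0, Pi.single x 1) : PhaseSpace N)) -
        (fderiv ℝ f z ((Pi.single x 1, 0) : PhaseSpace N) •
            (fderiv ℝ (fderiv ℝ g) z).flip ((0, Pi.single x 1) : PhaseSpace N) +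
          fderiv ℝ g z ((0, Pi.single x 1) : PhaseSpace N) •
            (fderiv ℝ (fderiv ℝ f) z).flip ((Pi.single x 1, 0) : PhaseSpace N)))) z := by
    rw [heq]
    refine HasFDerivAt.fun_sum fun x _ => ?_
    exact ((hasFDerivAt_fderiv_apply hf z _).mul (hasFDerivAt_fderiv_apply hg z _)).sub
      ((hasFDerivAt_fderiv_apply hf z _).mul (hasFDerivAt_fderiv_apply hg z _))
  rw [key.fderiv, sum_apply]
  refine Finset.sum_congr rfl fun x _ => ?_
  simp only [sub_apply, add_apply, smul_apply,
    ContinuousLinearMap.flip_apply, smul_eq_mul]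
  ring

/-- Second derivatives of a `C²` function are symmetric. [folklore] -/
theorem fderiv_fderiv_symm {f : PhaseSpace N → ℝ} (hf : ContDiff ℝ 2 f) (z v w : PhaseSpace N) :
    fderiv ℝ (fderiv ℝ f) z v w = fderiv ℝ (fderiv ℝ f) z w v :=
  (hf.contDiffAt.isSymmSndFDerivAt (by simp)) v w

/-- **Jacobi identity** for the canonical Poisson bracket:
`{f, {g, h}} + {g, {h, f}} + {h, {f, g}} = 0` for `f, g, h ∈ C²`. [cite: Arnold1989, §40 (C), Corollary 3] -/
theorem poisson_jacobi {f g h : PhaseSpace N → ℝ} (hf : ContDiff ℝ 2 f) (hg : ContDiff ℝ 2 g)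
    (hh : ContDiff ℝ 2 h) (z : PhaseSpace N) :
    poisson f (poisson g h) z + poisson g (poisson h f) z + poisson h (poisson f g) z = 0 := by
  -- notation: basis vectors and derivatives at `z`
  set Q : Fin N → PhaseSpace N := fun x => ((Pi.single x 1, 0) : PhaseSpace N) with hQ
  set P : Fin N → PhaseSpace N := fun x => ((0, Pi.single x 1) : PhaseSpace N) with hP
  -- the part of `{a, {b, c}}` in which the second derivative falls on `b`
  set B : (PhaseSpace N → ℝ) → (PhaseSpace N → ℝ) → (PhaseSpace N → ℝ) → ℝ := fun a b c =>
    ∑ x : Fin N, ∑ y : Fin N,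
      (fderiv ℝ a z (P x) *
          (fderiv ℝ (fderiv ℝ b) z (Q x) (P y) * fderiv ℝ c z (Q y) -
            fderiv ℝ (fderiv ℝ b) z (Q x) (Q y) * fderiv ℝ c z (P y)) -
        fderiv ℝ a z (Q x) *
          (fderiv ℝ (fderiv ℝ b) z (P x) (P y) * fderiv ℝ c z (Q y) -
            fderiv ℝ (fderiv ℝ b) z (P x) (Q y) * fderiv ℝ c z (P y))) with hB
  -- (1) `{a, {b, c}} = B(a,b,c) - B(a,c,b)`
  have key : ∀ {a b c : PhaseSpace N → ℝ}, ContDiff ℝ 2 a → ContDiff ℝ 2 b → ContDiff ℝ 2 c →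
      poisson a (poisson b c) z = B a b c - B a c b := by
    intro a b c ha hb hc
    rw [poisson_eq_fderiv (ha.differentiable (by norm_num)) (differentiable_poisson hb hc)]
    simp only [fderiv_poisson_apply hb hc, hB, Finset.mul_sum, ← Finset.sum_sub_distrib]
    refine Finset.sum_congr rfl fun x _ => Finset.sum_congr rfl fun y _ => ?_
    simp only [hQ, hP]
    ring
  -- (2) `B(c,b,a) = B(a,b,c)` (exchange the sums, symmetry of `D²b`)
  have symm : ∀ {a b c : PhaseSpace N → ℝ}, ContDiff ℝ 2 b → B c b a = B a b c := by
    intro a b c hb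
    simp only [hB]
    rw [Finset.sum_comm]
    refine Finset.sum_congr rfl fun x _ => Finset.sum_congr rfl fun y _ => ?_
    rw [fderiv_fderiv_symm hb z (Q y) (P x), fderiv_fderiv_symm hb z (Q y) (Q x),
      fderiv_fderiv_symm hb z (P y) (P x), fderiv_fderiv_symm hb z (P y) (Q x)]
    ring
  rw [key hf hg hh, key hg hh hf, key hh hf hg, symm (a := f) (c := h) hg, symm (a := f) (c := g) hh,
    symm (a := g) (c := h) hf]
  ring

/-- Jacobi identity in Leibniz form: `{f, {g, h}} = {{f, g}, h} + {g, {f, h}}` (`{f, ·}` is a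
derivation of the bracket), for `f, g, h ∈ C²`. [cite: Arnold1989, §40 (C)] -/
theorem poisson_leibniz_lie {f g h : PhaseSpace N → ℝ} (hf : ContDiff ℝ 2 f) (hg : ContDiff ℝ 2 g)
    (hh : ContDiff ℝ 2 h) (z : PhaseSpace N) :
    poisson f (poisson g h) z = poisson (poisson f g) h z + poisson g (poisson f h) z := by
  have hj := poisson_jacobi hf hg hh z
  have e1 : poisson (poisson f g) h z = -poisson h (poisson f g) z := poisson_antisymm _ _ z
  have e2 : poisson g (poisson f h) z = -poisson g (poisson h f) z := by
    rw [show poisson f h = fun w => -poisson h f w from funext fun w => poisson_antisymm f h w,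
      poisson_neg_right]
  linarith

end Literature.MathematicalPhysics.KineticTheory.HeatConduction

end
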